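import Summits.AtomisticToContinuum.FouriersLaw.Theses.PhononMeanFreePath
import Summits.AtomisticToContinuum.FouriersLaw.Theorems.PhononMeanFreePathDefs
import Summits.AtomisticToContinuum.FouriersLaw.Theorems.PhononMeanFreePathCoherentDephasingWeakCouplingIntegrability
import Summits.AtomisticToContinuum.FouriersLaw.Theorems.PhononMeanFreePathCoherentDephasingResponseRegularity
import Summits.AtomisticToContinuum.FouriersLaw.Theorems.PhononMeanFreePathCoherentDephasingMeanFieldDuhamel
import Summits.AtomisticToContinuum.FouriersLaw.Theorems.PhononMeanFreePathCoherentDephasingHarmFluxBound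
import Summits.AtomisticToContinuum.FouriersLaw.Theorems.PhononMeanFreePathCoherentDephasingSiteBookkeeping
import Summits.AtomisticToContinuum.FouriersLaw.Theorems.PhononMeanFreePathCoherentDephasingTelescoping
import Summits.AtomisticToContinuum.FouriersLaw.Theorems.PhononMeanFreePathCoherentDephasingLossComposition
import Summits.AtomisticToContinuum.FouriersLaw.Theorems.PhononMeanFreePathCoherentDephasingOfLocalLossBound
import Summits.AtomisticToContinuum.FouriersLaw.Theorems.PhononMeanFreePathCoherentDephasingBlockLoss

/-!
# The block loss reduction at ONE parameter point (line `Sketch`, crux stmt-AtomisticToContinuum-11810)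

Registered stubs `sliceAt_of_blockLossBoundAt` and `coherentDephasingWeakCoupling_of_cornerBlockLossBound` of the
lead's skeleton of line `Sketch` (coherent-field Beer–Lambert) of the crux `PhononMeanFreePath.CoherentDephasing`.

`…BlockLoss.coherentDephasing_of_blockLossBound` (p94687) derives the crux from the block loss bound
`κ Σ_{i<L₀} E_{x+i} ≤ Σ_{i<L₀} s'_{x+i}` (`E_x = cohEnergy x`, `s'_x = siteWork x + γ([x=0]+[x=N])∫₀^∞ m_x²`) assumed
at EVERY admissible parameter point `(ω₂, lam, β, γ, T)`; but its proof works entirely at the fixed point. Here that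
pointwise content is isolated: `sliceAt_of_blockLossBoundAt` says that at ONE parameter point the block loss bound
gives the crux's slice there — `r_N² ∈ L¹(0,∞)` for every `N` (unconditionally, `pairCorr_sq_integrableOn`) and
`N ∫₀^∞ r_N² → 0` (far-bath dissipation `≤ (2γ/κ)·B·θ^{⌊(⌊(N-L)/L₀⌋-1)/2⌋}`, `θ = 1/(1+κ)`, by the abstract
coarse-graining lemma `dissipation_le_geometric_blockLoss`, the `N`-uniform flux bound `stub_harmFluxBound`, the
fixed-`N` bookkeeping `stub_siteBookkeeping_of_meanField` on `stub_meanFieldDuhamel`/`stub_responseRegularity`,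
`∫₀^∞ m_x² ≤ 2 E_x` and `N θ^{(N-c)/L'} → 0`). Consequently the block loss bound on the weak-coupling corner
`lam T, β T ≤ ε₀(ω₂, γ)` already gives the regime item `CoherentDephasingWeakCoupling`
(`coherentDephasingWeakCoupling_of_cornerBlockLossBound`), and p94687 is the universal closure of the pointwise
lemma (`fun hLoss ω₂ lam β γ hω hl hβ hγ T hT => sliceAt_of_blockLossBoundAt … (hLoss ω₂ lam β γ hω hl hβ hγ T hT)`).
-/

noncomputable section

open MeasureTheory Set Filter Topology

namespace Summit.AtomisticToContinuum.FouriersLaw.Theorems.CoherentDephasing.BlockLossPointwise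

open Literature.MathematicalPhysics.KineticTheory.HeatConduction (pinnedChain PhaseSpace)
open Summit.AtomisticToContinuum.FouriersLaw.Theses.PhononMeanFreePath
  (CoherentDephasing CoherentDephasingWeakCoupling)
open Summit.AtomisticToContinuum.FouriersLaw.Theorems.PhononMeanFreePath
open Summit.AtomisticToContinuum.FouriersLaw.Theorems.CoherentDephasing.Telescoping (tendsto_natMul_pow_div)
open Summit.AtomisticToContinuum.FouriersLaw.Theorems.CoherentDephasing.MeanFieldDuhamel (stub_meanFieldDuhamel)
open Summit.AtomisticToContinuum.FouriersLaw.Theorems.CoherentDephasing.ResponseRegularity (stub_responseRegularity)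
open Summit.AtomisticToContinuum.FouriersLaw.Theorems.CoherentDephasing.SiteBookkeeping (stub_siteBookkeeping_of_meanField)
open Summit.AtomisticToContinuum.FouriersLaw.Theorems.CoherentDephasing.HarmFluxBound (stub_harmFluxBound)
open Summit.AtomisticToContinuum.FouriersLaw.Theorems.CoherentDephasing.LossComposition
  (integral_momResp_sq_le_two_cohEnergy)
open Summit.AtomisticToContinuum.FouriersLaw.Theorems.CoherentDephasing.OfLocalLossBound
  (sum_ite_succ_eq sum_ite_val_eq_of_lt sum_ite_val_eq_zero)
open Summit.AtomisticToContinuum.FouriersLaw.Theorems.CoherentDephasing.BlockLoss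
  (dissipation_le_geometric_blockLoss)

/-! ## The pointwise reduction -/

/-- **The crux's slice at one parameter point from the block loss bound there.** Fix `ω₂, lam, β, γ, T > 0`. If there
are a block length `L₀ ≥ 1`, a head margin `L`, a threshold `N₀` and a rate `κ > 0` such that for every chain with
`N ≥ N₀` and every block of `L₀` consecutive sites `x, …, x+L₀-1` beyond the head (`x ≥ L`, `x + L₀ ≤ N + 1`) the total
local loss summed over the block is at least `κ ×` the time-integrated coherent energy summed over the block, then
`t ↦ r_N(t)²` is integrable on `(0,∞)` for every `N` and `N ∫₀^∞ r_N² → 0` at this parameter point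
(`r_N = pairCorr … N = m_N`). The proof is that of `…BlockLoss.coherentDephasing_of_blockLossBound`, which never
leaves the parameter point. [folklore] -/
theorem sliceAt_of_blockLossBoundAt :
    ∀ ω₂ lam β γ : ℝ, 0 < ω₂ → 0 < lam → 0 < β → 0 < γ → ∀ T : ℝ, 0 < T →
      (∃ L₀ L N₀ : ℕ, ∃ κ : ℝ, 0 < L₀ ∧ 0 < κ ∧ ∀ N : ℕ, N₀ ≤ N → ∀ (x : ℕ) (hx : x + L₀ ≤ N + 1), L ≤ x →
        κ * ∑ i : Fin L₀, cohEnergy ω₂ lam β γ T N ⟨x + i, by omega⟩ ≤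
          ∑ i : Fin L₀, (siteWork ω₂ lam β γ T N ⟨x + i, by omega⟩ +
            γ * ((if x + (i : ℕ) = 0 then 1 else 0) + (if x + (i : ℕ) = N then 1 else 0)) *
              ∫ t in Set.Ioi (0 : ℝ), momResp ω₂ lam β γ T N ⟨x + i, by omega⟩ t ^ 2)) →
      (∀ N : ℕ, IntegrableOn (fun t : ℝ => pairCorr ω₂ lam β γ T N t ^ 2) (Set.Ioi 0)) ∧
        Tendsto (fun N : ℕ => (N : ℝ) * ∫ t in Set.Ioi (0 : ℝ), pairCorr ω₂ lam β γ T N t ^ 2) atTop (nhds 0) := by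
  intro ω₂ lam β γ hω hl hβ hγ T hT hLoss
  refine ⟨fun N => Summit.AtomisticToContinuum.FouriersLaw.Theorems.CoherentDephasing.pairCorr_sq_integrableOn
    hω hl.le hβ hγ hT N, ?_⟩
  obtain ⟨B, hBflux⟩ := stub_harmFluxBound ω₂ lam β γ hω hl hβ hγ T hT
  obtain ⟨L₀, L, N₀, κ, hL₀, hκ, hloss⟩ := hLoss
  have hbook := fun N => stub_siteBookkeeping_of_meanField ω₂ lam β γ hω hl hβ hγ T hT N
    (stub_meanFieldDuhamel ω₂ lam β γ hω hl hβ hγ T hT N) (stub_responseRegularity ω₂ lam β γ hω hl hβ hγ T hT N)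
  have h2E := integral_momResp_sq_le_two_cohEnergy ω₂ lam β γ hω hl hβ hγ T hT
  set D : ℕ → ℝ := fun N => γ * ∫ t in Ioi (0 : ℝ), momResp ω₂ lam β γ T N (Fin.last N) t ^ 2 with hD
  set θ : ℝ := 1 / (1 + κ) with hθ
  have hθ0 : 0 ≤ θ := by positivity
  have hθ1 : θ < 1 := by rw [hθ, div_lt_one (by positivity)]; linarith
  have hI0 : ∀ N : ℕ, 0 ≤ ∫ t in Ioi (0 : ℝ), momResp ω₂ lam β γ T N (Fin.last N) t ^ 2 := fun N =>
    setIntegral_nonneg measurableSet_Ioi fun t _ => sq_nonneg _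
  have hgeo : ∀ N : ℕ, N₀ ≤ N → L + L₀ ≤ N → D N ≤ 2 * γ / κ * B * θ ^ (((N - L) / L₀ - 1) / 2) := by
    intro N hN0 hN
    obtain ⟨hbal, htr⟩ := hbook N
    -- `ℕ`-indexed flux `J`, total local loss `S = s_x + [x = N] D_N` (for `x ≥ 1`) and site energy `E`, junk `0` out of range
    refine dissipation_le_geometric_blockLoss
      (fun b => if h : b < N then harmFlux ω₂ lam β γ T N ⟨b, h⟩ else 0)
      (fun x => (if h : x < N + 1 then siteWork ω₂ lam β γ T N ⟨x, h⟩ else 0) + (if x = N then D N else 0))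
      (fun x => if h : x < N + 1 then cohEnergy ω₂ lam β γ T N ⟨x, h⟩ else 0)
      (D N) (2 * γ) B κ N L L₀ hκ (by positivity) hL₀ hN ?_ ?_ ?_ ?_ ?_ ?_ ?_
    · -- `J N = 0`
      rw [dif_neg (lt_irrefl N)]
    · -- every flux `≤ B`
      intro b hb; rw [dif_pos hb]; exact hBflux N ⟨b, hb⟩
    · -- site balances beyond the head, read off the bookkeeping stub
      intro x hx1 hx2
      have h := hbal ⟨x, by omega⟩
      rw [sum_ite_succ_eq N _ (show ((⟨x, by omega⟩ : Fin (N + 1)) : ℕ) - 1 < N by simp only; omega)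
        (show ((⟨x, by omega⟩ : Fin (N + 1)) : ℕ) ≠ 0 by simp only; omega)] at h
      simp only at h
      rw [if_neg (by omega), if_neg (by omega)] at h
      rw [dif_pos (show x - 1 < N by omega), dif_pos (show x < N + 1 by omega)]
      by_cases hxN : x = N
      · have hfin : ∀ h : x < N + 1, (⟨x, h⟩ : Fin (N + 1)) = Fin.last N := fun _ => Fin.ext hxN
        rw [sum_ite_val_eq_zero N _ (show ¬ ((⟨x, _⟩ : Fin (N + 1)) : ℕ) < N by simp only; omega),
          if_pos hxN] at h
        rw [dif_neg (show ¬ x < N by omega), if_pos hxN]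
        simp only [hfin] at h ⊢
        simp only [hD]
        linarith
      · rw [sum_ite_val_eq_of_lt N _ (show ((⟨x, _⟩ : Fin (N + 1)) : ℕ) < N by simp only; omega),
          if_neg hxN] at h
        rw [dif_pos (show x < N by omega), if_neg hxN]
        simp only [add_zero, mul_zero] at h
        linarith
    · -- the block loss bound (the hypothesis), moved from `Fin L₀`-sums over the route objects to `range`-sums
      intro x hx1 hx2
      have h := hloss N hN0 x hx2 (le_of_lt hx1)
      have e1 : ∑ i : Fin L₀, cohEnergy ω₂ lam β γ T N ⟨x + i, by omega⟩ =
          ∑ i : Fin L₀, (fun y => if h : y < N + 1 then cohEnergy ω₂ lam β γ T N ⟨y, h⟩ else 0) (x + i) := by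
        refine Finset.sum_congr rfl fun i _ => ?_
        simp only
        rw [dif_pos (show x + (i : ℕ) < N + 1 by omega)]
      have e2 : ∑ i : Fin L₀, (siteWork ω₂ lam β γ T N ⟨x + i, by omega⟩ +
            γ * ((if x + (i : ℕ) = 0 then 1 else 0) + (if x + (i : ℕ) = N then 1 else 0)) *
              ∫ t in Set.Ioi (0 : ℝ), momResp ω₂ lam β γ T N ⟨x + i, by omega⟩ t ^ 2) =
          ∑ i : Fin L₀, (fun y => (if h : y < N + 1 then siteWork ω₂ lam β γ T N ⟨y, h⟩ else 0) +
            (if y = N then D N else 0)) (x + i) := by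
        refine Finset.sum_congr rfl fun i _ => ?_
        simp only
        rw [dif_pos (show x + (i : ℕ) < N + 1 by omega), if_neg (show x + (i : ℕ) ≠ 0 by omega)]
        by_cases hxN : x + (i : ℕ) = N
        · have hfin : ∀ h : x + (i : ℕ) < N + 1, (⟨x + i, h⟩ : Fin (N + 1)) = Fin.last N :=
            fun _ => Fin.ext hxN
          rw [if_pos hxN, if_pos hxN, hfin]
          simp only [hD]
          ring
        · rw [if_neg hxN, if_neg hxN]
          ring
      rw [e1, e2] at h
      rw [Finset.sum_range, Finset.sum_range]
      exact h
    · -- `E ≥ 0`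
      intro x
      split_ifs
      · exact cohEnergy_nonneg ω₂ lam β γ T N hω.le _
      · exact le_rfl
    · -- transport
      intro b hb
      rw [dif_pos (show b < N by omega), dif_pos (show b < N + 1 by omega), dif_pos (show b + 1 < N + 1 by omega)]
      exact htr ⟨b, by omega⟩
    · -- `D N ≤ 2γ E_N`
      rw [dif_pos (Nat.lt_succ_self N)]
      have hlast : (⟨N, Nat.lt_succ_self N⟩ : Fin (N + 1)) = Fin.last N := rfl
      rw [hlast]
      simp only [hD]
      have := h2E N (Fin.last N)
      nlinarith [hγ]
  -- the exponent `((N - L)/L₀ - 1)/2 = (N - (L + L₀))/(L₀ · 2)` for `L + L₀ ≤ N`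
  have hexp : ∀ N : ℕ, L + L₀ ≤ N → ((N - L) / L₀ - 1) / 2 = (N - (L + L₀)) / (L₀ * 2) := by
    intro N hN
    rw [← Nat.sub_mul_div (N - L) L₀ 1, Nat.div_div_eq_div_mul]
    congr 1
    omega
  -- squeeze `0 ≤ N ∫ m_N² ≤ (N/γ)(2γ/κ) B θ^{…} → 0`
  have hlim := (tendsto_natMul_pow_div θ hθ0 hθ1 (L₀ * 2) (by positivity) (L + L₀)).const_mul (2 * γ / κ * B / γ)
  rw [mul_zero] at hlim
  change Tendsto (fun N : ℕ => (N : ℝ) * ∫ t in Ioi (0 : ℝ), momResp ω₂ lam β γ T N (Fin.last N) t ^ 2) atTop (𝓝 0)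
  refine squeeze_zero' (Eventually.of_forall fun N => mul_nonneg (Nat.cast_nonneg N) (hI0 N)) ?_ hlim
  filter_upwards [eventually_ge_atTop (max N₀ (L + L₀))] with N hN
  have hN0 : N₀ ≤ N := le_of_max_le_left hN
  have hN1 : L + L₀ ≤ N := le_of_max_le_right hN
  have h1 : (N : ℝ) * ∫ t in Ioi (0 : ℝ), momResp ω₂ lam β γ T N (Fin.last N) t ^ 2 = (N : ℝ) * (D N / γ) := by
    simp only [hD]; field_simp
  rw [h1]
  have h2 : D N / γ ≤ 2 * γ / κ * B / γ * θ ^ ((N - (L + L₀)) / (L₀ * 2)) := by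
    have := div_le_div_of_nonneg_right (hgeo N hN0 hN1) hγ.le
    rw [hexp N hN1] at this
    calc D N / γ ≤ 2 * γ / κ * B * θ ^ ((N - (L + L₀)) / (L₀ * 2)) / γ := this
      _ = 2 * γ / κ * B / γ * θ ^ ((N - (L + L₀)) / (L₀ * 2)) := by ring
  calc (N : ℝ) * (D N / γ) ≤ (N : ℝ) * (2 * γ / κ * B / γ * θ ^ ((N - (L + L₀)) / (L₀ * 2))) :=
      mul_le_mul_of_nonneg_left h2 (Nat.cast_nonneg N)
    _ = 2 * γ / κ * B / γ * ((N : ℝ) * θ ^ ((N - (L + L₀)) / (L₀ * 2))) := by ring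

/-! ## Consequence: the weak-coupling corner -/

/-- **`CoherentDephasingWeakCoupling` from the block loss bound on the weak-coupling corner.** If for every
`ω₂, γ > 0` there is `ε₀ > 0` such that the block loss bound holds at every parameter point with `lam T ≤ ε₀` and
`β T ≤ ε₀` (`lam, β, T > 0`), then the regime item `CoherentDephasingWeakCoupling` holds (by name): its slice at each
such point is `sliceAt_of_blockLossBoundAt`, the route's `r_N` being `pairCorr … N` verbatim. [folklore] -/
theorem coherentDephasingWeakCoupling_of_cornerBlockLossBound :
    (∀ ω₂ γ : ℝ, 0 < ω₂ → 0 < γ → ∃ ε₀ : ℝ, 0 < ε₀ ∧ ∀ lam β T : ℝ, 0 < lam → 0 < β → 0 < T →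
      lam * T ≤ ε₀ → β * T ≤ ε₀ →
      ∃ L₀ L N₀ : ℕ, ∃ κ : ℝ, 0 < L₀ ∧ 0 < κ ∧ ∀ N : ℕ, N₀ ≤ N → ∀ (x : ℕ) (hx : x + L₀ ≤ N + 1), L ≤ x →
        κ * ∑ i : Fin L₀, cohEnergy ω₂ lam β γ T N ⟨x + i, by omega⟩ ≤
          ∑ i : Fin L₀, (siteWork ω₂ lam β γ T N ⟨x + i, by omega⟩ +
            γ * ((if x + (i : ℕ) = 0 then 1 else 0) + (if x + (i : ℕ) = N then 1 else 0)) *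
              ∫ t in Set.Ioi (0 : ℝ), momResp ω₂ lam β γ T N ⟨x + i, by omega⟩ t ^ 2)) →
    Summit.AtomisticToContinuum.FouriersLaw.Theses.PhononMeanFreePath.CoherentDephasingWeakCoupling := by
  intro h ω₂ γ hω hγ
  obtain ⟨ε₀, hε, hc⟩ := h ω₂ γ hω hγ
  refine ⟨ε₀, hε, fun lam β T hl hβ hT hlT hβT => ?_⟩
  exact sliceAt_of_blockLossBoundAt ω₂ lam β γ hω hl hβ hγ T hT (hc lam β T hl hβ hT hlT hβT)

end Summit.AtomisticToContinuum.FouriersLaw.Theorems.CoherentDephasing.BlockLossPointwise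

end
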